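import Literature.Computability.AlgebraicComplexity.MatrixMultiplicationExponent
import Mathlib.GroupTheory.Exponent

/-!
# The group-theoretic approach to matrix multiplication: STPP constructions in abelian groups

Trunk: Computability/AlgebraicComplexity. The simultaneous triple product property (STPP) of
Cohn–Kleinberg–Szegedy–Umans for families of triples of subsets of a finite ABELIAN group
(additive notation), and two named literature facts (`def … : Prop`, never asserted):

* `IsSTPP A B C` — Cohn–Kleinberg–Szegedy–Umans 2005, Def. 5.1 = Blasiak–Church–Cohn–Grochow–
  Naslund–Sawin–Umans 2017, Def. 2.2, in the additive form used by the latter's §3.1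
  (`S_i = A_i − B_i`, `T_i = B_i − C_i`, `U_i = C_i − A_i`; `s_i + t_j + u_k = 0 ⇒ i = j = k`,
  and for `i = j = k` the triple product property
  `a − a' + b − b' + c − c' = 0 ⇒ a = a', b = b', c = c'`).
  Written with the six group elements explicit so that it is literally the predicate inlined in
  the route statements of `MatrixMultiplication/GroupTheoreticSTPP`.
* `CohnKleinbergSzegedyUmans2005_5_5_abelian` — CKSU 2005, Thm. 5.5 ("If a group `H`
  simultaneously realizes `⟨a₁,b₁,c₁⟩, …, ⟨aₙ,bₙ,cₙ⟩` and has character degrees `{d_k}`, then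
  `Σᵢ (aᵢbᵢcᵢ)^{ω/3} ≤ Σ_k d_k^ω`. Frequently `H` will be abelian, in which case
  `Σ_k d_k^ω = |H|`"), abelian case = BCCGNSU 2017, (1.1): `Σᵢ (|Aᵢ||Bᵢ||Cᵢ|)^{ω/3} ≤ |H|`.
* `BlasiakChurchCohnGrochowNaslundSawinUmans2017_B` — BCCGNSU 2017, Thm. B ("For every `ℓ ∈ ℕ`,
  there is an `ε_ℓ > 0` such that no STPP construction in any abelian group of exponent at most
  `ℓ` is large enough to yield a bound better than `ω ≤ 2 + ε_ℓ` via the inequality (1.1)"), in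
  the effective reading: `Σᵢ (|Aᵢ||Bᵢ||Cᵢ|)^{(2+ε_ℓ)/3} ≤ |H|` for every such construction (a
  bound `ω ≤ τ` "via (1.1)" is the `τ` with `Σᵢ (|Aᵢ||Bᵢ||Cᵢ|)^{τ/3} ≥ |H|`, by monotonicity of
  `τ ↦ Σ xᵢ^{τ/3}` for `xᵢ ≥ 1`).

`ω` is the tree's `Literature.CplxAlg.omega ℂ` (Bläser 2013, Def. 5.1, rank form; equal to the
arithmetic-complexity exponent used by CKSU, Bläser 2013 Thm. 5.2).

## References

* H. Cohn, R. Kleinberg, B. Szegedy, C. Umans, *Group-theoretic algorithms for matrix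
  multiplication*, FOCS 2005, arXiv:math/0511460: Def. 5.1 (p. 7), Thm. 5.5 (p. 8), Conj. 4.7.
* J. Blasiak, T. Church, H. Cohn, J. A. Grochow, E. Naslund, W. F. Sawin, C. Umans, *On cap sets
  and the group-theoretic approach to matrix multiplication*, Discrete Analysis 2017:3,
  arXiv:1605.06702: (1.1), Def. 2.2, Def. 2.3, Lemma 2.4, Thm. A, Thm. B (pp. 2–5).
-/

noncomputable section

namespace Literature.Computability.AlgebraicComplexity

open Finset

/-- **Simultaneous triple product property** for `N` triples `(A i, B i, C i)` of subsets of an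
additive abelian group `H` (Cohn–Kleinberg–Szegedy–Umans 2005, Def. 5.1; Blasiak et al. 2017,
Def. 2.2, additive form of §3.1): whenever `s' ∈ A i`, `s ∈ A k`, `t' ∈ B j`, `t ∈ B i`,
`u' ∈ C k`, `u ∈ C j` satisfy `(s' − s) + (t' − t) + (u' − u) = 0` — equivalently
`(s' − t) + (t' − u) + (u' − s) ∈ (A i − B i) + (B j − C j) + (C k − A k)` vanishes — then
`i = j = k` (simultaneity) and `s = s'`, `t = t'`, `u = u'` (the triple product property of each
triple). [cite: CohnKleinbergSzegedyUmans2005, Def. 5.1]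
[cite: BlasiakChurchCohnGrochowNaslundSawinUmans2017, Def. 2.2] -/
def IsSTPP {H : Type*} [AddCommGroup H] {N : ℕ} (A B C : Fin N → Finset H) : Prop :=
  ∀ i j k : Fin N, ∀ s ∈ A k, ∀ s' ∈ A i, ∀ t ∈ B i, ∀ t' ∈ B j, ∀ u ∈ C j, ∀ u' ∈ C k,
    (s' - s) + (t' - t) + (u' - u) = 0 → i = j ∧ j = k ∧ s = s' ∧ t = t' ∧ u = u'

/-- Unfolding `IsSTPP` to the predicate inlined in the route statements (by `Iff.rfl`).
[folklore] -/
theorem isSTPP_iff {H : Type*} [AddCommGroup H] {N : ℕ} (A B C : Fin N → Finset H) :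
    IsSTPP A B C ↔
      ∀ i j k : Fin N, ∀ s ∈ A k, ∀ s' ∈ A i, ∀ t ∈ B i, ∀ t' ∈ B j, ∀ u ∈ C j, ∀ u' ∈ C k,
        (s' - s) + (t' - t) + (u' - u) = 0 → i = j ∧ j = k ∧ s = s' ∧ t = t' ∧ u = u' :=
  Iff.rfl

/-- The empty family is an STPP construction. [folklore] -/
theorem isSTPP_zero {H : Type*} [AddCommGroup H] (A B C : Fin 0 → Finset H) : IsSTPP A B C :=
  fun i => i.elim0

/-- (Cohn–Kleinberg–Szegedy–Umans 2005, Thm. 5.5, p. 8: "If a group `H` simultaneously realizes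
`⟨a₁, b₁, c₁⟩, …, ⟨aₙ, bₙ, cₙ⟩` and has character degrees `{d_k}`, then
`Σᵢ (aᵢ bᵢ cᵢ)^{ω/3} ≤ Σ_k d_k^ω`. Frequently `H` will be abelian, in which case `Σ_k d_k^ω = |H|`";
Blasiak et al. 2017, (1.1).) **The fundamental inequality of the group-theoretic approach,
abelian case**: for every finite abelian group `H` and every STPP construction
`(A i, B i, C i)_{i < N}` in `H`, `Σᵢ (|A i| |B i| |C i|)^{ω(ℂ)/3} ≤ |H|`.
[cite: CohnKleinbergSzegedyUmans2005, Thm. 5.5]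
[cite: BlasiakChurchCohnGrochowNaslundSawinUmans2017, (1.1)] -/
def CohnKleinbergSzegedyUmans2005_5_5_abelian : Prop :=
  ∀ (H : Type) [AddCommGroup H] [Fintype H] (N : ℕ) (A B C : Fin N → Finset H), IsSTPP A B C →
    ∑ i, (((A i).card * (B i).card * (C i).card : ℕ) : ℝ) ^ (omega ℂ / 3) ≤ (Fintype.card H : ℝ)

/-- (Blasiak–Church–Cohn–Grochow–Naslund–Sawin–Umans 2017, Thm. B, p. 3: "For every `ℓ ∈ ℕ`, there
is an `ε_ℓ > 0` such that no STPP construction in any abelian group of exponent at most `ℓ` is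
large enough to yield a bound better than `ω ≤ 2 + ε_ℓ` via the inequality (1.1).")
**Bounded-exponent abelian groups cannot give `ω = 2`**, effective reading: for every `ℓ` there
is `ε > 0` such that for every finite abelian group `H` of exponent at most `ℓ` and every STPP
construction in `H`, `Σᵢ (|A i| |B i| |C i|)^{(2+ε)/3} ≤ |H|`.
[cite: BlasiakChurchCohnGrochowNaslundSawinUmans2017, Thm. B] -/
def BlasiakChurchCohnGrochowNaslundSawinUmans2017_B : Prop :=
  ∀ ℓ : ℕ, ∃ ε : ℝ, 0 < ε ∧
    ∀ (H : Type) [AddCommGroup H] [Fintype H], AddMonoid.exponent H ≤ ℓ →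
      ∀ (N : ℕ) (A B C : Fin N → Finset H), IsSTPP A B C →
        ∑ i, (((A i).card * (B i).card * (C i).card : ℕ) : ℝ) ^ ((2 + ε) / 3) ≤
          (Fintype.card H : ℝ)

end Literature.Computability.AlgebraicComplexity
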